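import Mathlib.Analysis.Calculus.MeanValue
import Mathlib.Analysis.SpecialFunctions.ExpDeriv
import Mathlib.Topology.Order.DenselyOrdered
import HarnessLib

/-!
# Chen–Hou's stability lemmas for `L^∞`-type energies along characteristics
# (the "stability lemma" of the computer-assisted blow-up framework), with the printed constants

Topic `Literature/Analysis/FluidPDE`. PROVED theorems only (no definitions, no named facts); the
printed constants of the framework are recorded in the sibling `ChenHouFrameworkConstants.lean`.

J. Chen, T. Y. Hou, *Stable nearly self-similar blowup of the 2D Boussinesq and 3D Euler equations
with smooth data I: Analysis*, arXiv:2210.07191 [arXiv221007191], Appendix A.1 "Some Lemmas for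
stability estimates" (§8 of the held arXiv rendering, p. 71–72), and Part II *Rigorous numerics*,
arXiv:2305.05660 [ChenHou2023RigorousNumerics], §2 Lemma 2.1 (the same nonlinear lemma restated:
"proved in Appendix A.1 of Part I"). These two lemmas are the abstract engine of the Chen–Hou
framework (Part I §2.3: "we can use Lemma (lem:PDE_nonstab) to obtain nonlinear stability";
Lemma 2.4: "For `E_* = 5·10⁻⁶`, the coefficients in the nonlinear energy estimates of `E₄(t)`
satisfy the conditions (eq:PDE_nondiag), and the statements in Theorem 3 hold true" — the
inequalities being verified with computer assistance in Part II).

## The printed statements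

**Lemma A.1 (linear stability; Lemma 8.1 of the rendering).** Suppose `f_i(x,z,t)`,
`1 ≤ i ≤ n`, satisfy `∂ₜ f_i + v_i·∇_{x,z} f_i = −a_ii(x,z,t) f_i + B_i(x,z,t)` with Lipschitz
transport fields `v_i` tangent to the boundary, and `|B_i| ≤ Σ_{j≠i} |a_ij| ‖f_j‖_{L^∞}`. If for
some constants `M, λ, μ_i > 0` and all `(x,z)`:
`a_ii − Σ_{j≠i} |a_ij| μ_i μ_j⁻¹ ≥ λ` and `Σ_{j≠i} μ_i μ_j⁻¹ |a_ij| ≤ M`, then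
`E(t) = maxᵢ(μ_i ‖f_i(t)‖_∞)` satisfies `E(t) ≤ e^{−λ(t−t₀)} E(t₀)` for `0 ≤ t₀ < t ≤ T`.

**Lemma A.2 = Part II Lemma 2.1 (nonlinear stability).** Same setting with
`∂ₜ f_i + v_i·∇ f_i = −a_ii f_i + B_i + N_i + ε̄_i`, `E(t) = maxᵢ(μ_i‖f_i‖_∞)`, and
`μ_i(|B_i| + |N_i| + |ε̄_i|) ≤ Σ_{j≠i}(|a_ij| E(t) + |a_ij,2| E(t)² + |a_ij,3|)`. "If there exists some
`E_*, ε₀, M > 0` such that `a_ii E_* − Σ_{j≠i}(|a_ij|E_* + |a_ij,2|E_*² + |a_ij,3|) > ε₀` and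
`Σ_{j≠i}(|a_ij|E_* + |a_ij,2|E_*² + |a_ij,3|) < M` for all `x, z` and `t ∈ [0,T]`. Then for
`E(0) < E_*`, we have `E(t) < E_*` for `t ∈ [0,T]`." ("The second inequality in (eq:PDE_nondiag)
is only qualitative.")

The printed proofs pass to the characteristics `(X_i(t), Z_i(t))` of `v_i`, along which
`F_i(t) = f_i(X_i(t), Z_i(t), t)` solves the ODE `F_i' = −A_i(t) F_i + (forcing)` with
`A_i(t) = a_ii(X_i, Z_i, t)`, and close a bootstrap on `E(t) = sup` over components and starting
points; Chen–Hou also apply the lemmas to scalar unknowns `a_i(t)` ("advection term is `0`").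

## Rendering: the trajectory (characteristics) form, which is what the proofs establish

We state and prove both lemmas directly for an arbitrary family of real trajectories indexed by a
type `ι` (think `ι = {components} × {starting points}`; the scalar case is `ι` finite): functions
`F k : ℝ → ℝ` with a right derivative `F_k'(t) = −A k t · F k t + G k t` on `[t₀, T)` and continuous
on `[t₀, T]`, weights `μ k > 0`, and an energy `E : ℝ → ℝ`, continuous on `[t₀,T]`, which IS the
supremum `E(t) = sup_k μ_k |F_k(t)|` (`IsLUB`; for the PDE this is `maxᵢ μ_i ‖f_i(t)‖_{L^∞}` since
the characteristics of each `v_i` sweep the domain). The forcing hypotheses are the printed ones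
read along the trajectory (`μ_k|G_k(t)| ≤ C_k(t) E(t)` with `A_k − C_k ≥ λ`, `0 ≤ C_k ≤ M`, resp.
`μ_k|G_k(t)| ≤ Φ_k(t, E(t))` with `Φ_k(t,·)` monotone on `[0,E_*]`, `A_k E_* − Φ_k(t,E_*) > ε₀`,
`Φ_k(t,E_*) < M`); the printed quadratic form `Φ = Σ(|a_ij|e + |a_ij,2|e² + |a_ij,3|)` is the
corollary `chenHou_nonlinear_stability_quadratic`. The passage PDE → characteristics (existence of
the flow of a Lipschitz field tangent to the boundary, `‖f_i(t)‖_∞ = sup` over starting points) is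
standard and not part of this file; nothing weaker than the printed conclusion is claimed for the
objects treated here.

Proof technique (ours, replacing Duhamel's formula along characteristics by a barrier argument,
same mathematics): for one trajectory and one sign, `±μ_k F_k` cannot cross a barrier because at a
touching point its derivative is strictly below the barrier's (Mathlib's
`image_le_of_deriv_right_lt_deriv_boundary'`); the simultaneous bootstrap over all trajectories
is closed by continuity of `E` at the infimum of the bad times. In the linear lemma the constant `M`
absorbs the continuity slack; in the nonlinear lemma `M` yields the uniform contraction factor
`1 − δ`, `δ = min(½, ε₀/(2M))`, as in the printed proof ("`C_i(s) < min(M, A_i E_* − ε₀) <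
(1−δ)A_iE_*`").

## Constants (sibling file `ChenHouFrameworkConstants.lean`; Part I Thm 3 = Part II Thm 3)

`E_* = 5·10⁻⁶`; conclusion `‖ω−ω̄‖_∞, ‖θ_x−θ̄_x‖_∞, ‖θ_y−θ̄_y‖_∞ < 200E_*`,
`|u_x(t,0) − ū_x(0)|, |c̄_ω − c_ω| < 100E_*`; finite rank `< 50` (Part I Lemmas 2.2–2.3 = Part II
Lemmas 2.3–2.4). WHAT THIS IS NOT: parameters of a computer-assisted proof about a numerically
computed profile; nothing here is about Navier–Stokes.

## Mathlib / tree search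

`lean search 'nonlinear_stability|bootstrap|PDE_nonstab|ChenHouStab'`: nothing (the tree's
`ChenHou*` files vendor the blow-up theorem and the meridian system; `DynamicRescalingBlowup.lean` the
rescaling bookkeeping). Mathlib: `image_le_of_deriv_right_lt_deriv_boundary'` (barrier),
`exists_lt_of_csInf_lt`, `csInf_le`, `le_csInf` (infimum of the bad set), `le_of_tendsto`.
-/

noncomputable section

open Set Filter Topology

namespace Literature.Analysis.FluidPDE

/-! ### Helpers: the supremum energy and the bootstrap closure -/

section Sup

variable {ι : Type*}

/-- An `IsLUB` of a family of nonnegative reals is nonnegative (the index type is then nonempty,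
since `ℝ` has no bottom element). [folklore] -/
private theorem isLUB_range_nonneg {g : ι → ℝ} {e : ℝ} (h : IsLUB (Set.range g) e)
    (hg : ∀ k, 0 ≤ g k) : 0 ≤ e := by
  rcases isEmpty_or_nonempty ι with hι | ⟨⟨k⟩⟩
  · rw [Set.range_eq_empty] at h
    exact absurd (isLUB_empty_iff.mp h) (not_isBot e)
  · exact (hg k).trans (h.1 ⟨k, rfl⟩)

/-- If every member of the family is `≤ b` then the least upper bound is `≤ b`. [folklore] -/
private theorem isLUB_range_le {g : ι → ℝ} {e b : ℝ} (h : IsLUB (Set.range g) e)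
    (hg : ∀ k, g k ≤ b) : e ≤ b :=
  h.2 (by rintro _ ⟨k, rfl⟩; exact hg k)

end Sup

/-- **Bootstrap closure.** Let `W, b` be continuous on `[t₀, T]` with `W t₀ ≤ b t₀` and `b`
monotone. If there is a slack `ρ > 0` such that, for every `v ∈ [t₀, T]`, the "slack bootstrap"
`∀ s ∈ [t₀,v], W s ≤ b s + ρ` implies the sharp bound `W v ≤ b v`, then `W ≤ b` on `[t₀, T]`
(continuity of `W` at the infimum of the bad times supplies the slack). [folklore] -/
private theorem bootstrap_closure {t₀ T ρ : ℝ} {W b : ℝ → ℝ} (hρ : 0 < ρ)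
    (hW : ContinuousOn W (Icc t₀ T)) (hb : ContinuousOn b (Icc t₀ T))
    (hbm : MonotoneOn b (Icc t₀ T)) (h0 : W t₀ ≤ b t₀)
    (step : ∀ v ∈ Icc t₀ T, (∀ s ∈ Icc t₀ v, W s ≤ b s + ρ) → W v ≤ b v) :
    ∀ t ∈ Icc t₀ T, W t ≤ b t := by
  by_contra hcon
  simp only [not_forall, not_le, exists_prop] at hcon
  obtain ⟨t₂, ht₂, hlt⟩ := hcon
  set V : Set ℝ := {t | t ∈ Icc t₀ T ∧ b t < W t} with hV
  have hVne : V.Nonempty := ⟨t₂, ht₂, hlt⟩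
  have hVbdd : BddBelow V := ⟨t₀, fun t ht => ht.1.1⟩
  set ts := sInf V with hts
  have hts_ge : t₀ ≤ ts := le_csInf hVne fun t ht => ht.1.1
  have hts_le : ts ≤ t₂ := csInf_le hVbdd ⟨ht₂, hlt⟩
  have hts_mem : ts ∈ Icc t₀ T := ⟨hts_ge, hts_le.trans ht₂.2⟩
  -- below `ts`, the sharp bound holds
  have hbelow : ∀ u ∈ Icc t₀ T, u < ts → W u ≤ b u := fun u hu hult => by
    by_contra h
    exact (not_le.mpr hult) (csInf_le hVbdd ⟨hu, not_le.mp h⟩)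
  -- at `ts`, the sharp bound holds (left limit, or `ts = t₀`)
  have hWts : W ts ≤ b ts := by
    rcases eq_or_lt_of_le hts_ge with h0' | hpos
    · rw [← h0']; exact h0
    · have hcW : ContinuousWithinAt (fun u => W u - b u) (Ico t₀ ts) ts :=
        ((hW ts hts_mem).sub (hb ts hts_mem)).mono fun u hu => ⟨hu.1, hu.2.le.trans hts_mem.2⟩
      haveI : (𝓝[Ico t₀ ts] ts).NeBot := by
        apply mem_closure_iff_nhdsWithin_neBot.mp
        rw [closure_Ico hpos.ne]
        exact ⟨hts_ge, le_rfl⟩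
      have hle : W ts - b ts ≤ 0 := by
        refine le_of_tendsto hcW ?_
        filter_upwards [self_mem_nhdsWithin] with u hu
        exact sub_nonpos.mpr (hbelow u ⟨hu.1, hu.2.le.trans hts_mem.2⟩ hu.2)
      linarith
  -- continuity slack: `W < b ts + ρ` near `ts` within `[t₀, T]`
  have hroom : ∀ᶠ u in 𝓝[Icc t₀ T] ts, W u < b ts + ρ :=
    (hW ts hts_mem).eventually_lt_const (by linarith)
  obtain ⟨η, hη, hηP⟩ : ∃ η > 0, ∀ u ∈ Icc t₀ T, dist u ts < η → W u < b ts + ρ := by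
    rcases Metric.mem_nhdsWithin_iff.mp hroom with ⟨η, hη, hsub⟩
    exact ⟨η, hη, fun u hu hd => hsub ⟨hd, hu⟩⟩
  -- a bad time `v` just above `ts`
  obtain ⟨v, hvV, hvlt⟩ := exists_lt_of_csInf_lt hVne (show sInf V < ts + η by linarith)
  have htsv : ts ≤ v := csInf_le hVbdd hvV
  -- the slack bootstrap holds on `[t₀, v]`
  have hslack : ∀ s ∈ Icc t₀ v, W s ≤ b s + ρ := fun s hs => by
    have hsT : s ∈ Icc t₀ T := ⟨hs.1, hs.2.trans hvV.1.2⟩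
    rcases lt_or_ge s ts with h | h
    · linarith [hbelow s hsT h]
    · have hd : dist s ts < η := by
        rw [Real.dist_eq, abs_of_nonneg (by linarith)]; linarith [hs.2]
      have h1 := hηP s hsT hd
      have h2 : b ts ≤ b s := hbm hts_mem hsT h
      linarith
  exact (not_le.mpr hvV.2) (step v hvV.1 hslack)

/-! ### Lemma A.2 / Part II Lemma 2.1: nonlinear stability (bootstrap) -/

section Nonlinear

variable {ι : Type*} {T Estar ε₀ M : ℝ} {μ : ι → ℝ} {F A G : ι → ℝ → ℝ} {Φ : ι → ℝ → ℝ → ℝ}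
  {E : ℝ → ℝ}

/-- **Chen–Hou's nonlinear stability lemma** (Part I, Appendix A.1, second lemma; restated as
Part II, Lemma 2.1), trajectory form. Trajectories `F k` (`k : ι`) with right derivative
`F_k' = −A_k F_k + G_k` on `[0,T)`, continuous on `[0,T]`; weights `μ_k > 0`; energy
`E(t) = sup_k μ_k|F_k(t)|` (an `IsLUB`), continuous on `[0,T]`; forcing bound
`μ_k|G_k(t)| ≤ Φ_k(t, E(t))` with `Φ_k(t,·)` monotone on `[0,E_*]` (printed:
`Φ = Σ_{j≠i}(|a_ij|E + |a_ij,2|E² + |a_ij,3|)`, see `chenHou_nonlinear_stability_quadratic`);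
stability conditions (eq:PDE_nondiag): `A_k(t)E_* − Φ_k(t,E_*) > ε₀` and `Φ_k(t,E_*) < M` with
`E_*, ε₀, M > 0`. Conclusion: `E(0) < E_* ⟹ E(t) < E_*` for all `t ∈ [0,T]`; in fact
`E(t) ≤ max(E(0), (1−δ)E_*)`, `δ = min(½, ε₀/(2M))`, as in the printed proof. [cite: ChenHou2023RigorousNumerics, Lemma 2.1 (= arXiv:2210.07191 Appendix A.1, nonlinear stability lemma)] -/
theorem chenHou_nonlinear_stability (hEstar : 0 < Estar) (hε₀ : 0 < ε₀) (hM : 0 < M)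
    (hμ : ∀ k, 0 < μ k)
    (hFc : ∀ k, ContinuousOn (F k) (Icc 0 T))
    (hF : ∀ k, ∀ t ∈ Ico 0 T, HasDerivWithinAt (F k) (-A k t * F k t + G k t) (Ici t) t)
    (hG : ∀ k, ∀ t ∈ Icc 0 T, μ k * |G k t| ≤ Φ k t (E t))
    (hΦ : ∀ k, ∀ t ∈ Icc 0 T, MonotoneOn (Φ k t) (Icc 0 Estar))
    (hgap : ∀ k, ∀ t ∈ Icc 0 T, ε₀ < A k t * Estar - Φ k t Estar)
    (hbd : ∀ k, ∀ t ∈ Icc 0 T, Φ k t Estar < M)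
    (hEc : ContinuousOn E (Icc 0 T))
    (hE : ∀ t ∈ Icc 0 T, IsLUB (Set.range fun k => μ k * |F k t|) (E t))
    (h0 : E 0 < Estar) :
    ∀ t ∈ Icc 0 T, E t < Estar := by
  -- nonnegativity of the energy
  have hE0 : ∀ t ∈ Icc 0 T, 0 ≤ E t := fun t ht =>
    isLUB_range_nonneg (hE t ht) fun k => mul_nonneg (hμ k).le (abs_nonneg _)
  -- the contraction parameter `δ` and the improved bound `B < E_*`
  set δ : ℝ := min (1 / 2) (ε₀ / (2 * M)) with hδ
  have hδpos : 0 < δ := lt_min (by norm_num) (by positivity)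
  have hδhalf : δ ≤ 1 / 2 := min_le_left _ _
  have hδM : δ ≤ ε₀ / (2 * M) := min_le_right _ _
  set B : ℝ := max (E 0) ((1 - δ) * Estar) with hB
  have hBlt : B < Estar := max_lt h0 (by nlinarith)
  have hBpos : 0 < B := lt_of_lt_of_le (by nlinarith) (le_max_right _ _)
  have hBge : (1 - δ) * Estar ≤ B := le_max_right _ _
  have hρ : 0 < Estar - B := sub_pos.mpr hBlt
  -- the key pointwise inequality under the bootstrap `E t ≤ E_*`:
  -- `A_k(t) > 0` and `Φ_k(t, E t) < (1 - δ) A_k(t) E_*`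
  have key : ∀ k, ∀ t ∈ Icc 0 T, E t ≤ Estar →
      0 < A k t ∧ Φ k t (E t) < (1 - δ) * (A k t * Estar) := by
    intro k t ht hboot
    have hΦ0 : 0 ≤ Φ k t (E t) := (mul_nonneg (hμ k).le (abs_nonneg _)).trans (hG k t ht)
    have hmono : Φ k t (E t) ≤ Φ k t Estar :=
      hΦ k t ht ⟨hE0 t ht, hboot⟩ ⟨hEstar.le, le_rfl⟩ hboot
    have hg := hgap k t ht
    have hb := hbd k t ht
    have hAE : 0 < A k t * Estar := by linarith
    have hApos : 0 < A k t := (mul_pos_iff_of_pos_right hEstar).mp hAE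
    refine ⟨hApos, lt_of_le_of_lt hmono ?_⟩
    by_cases hc : A k t * Estar ≤ 2 * M
    · have h1 : δ * (A k t * Estar) ≤ ε₀ := by
        calc δ * (A k t * Estar) ≤ ε₀ / (2 * M) * (2 * M) :=
              mul_le_mul hδM hc hAE.le (by positivity)
          _ = ε₀ := by field_simp
      nlinarith
    · have hc' : 2 * M < A k t * Estar := not_le.mp hc
      nlinarith
  -- one trajectory, one sign, under the slack bootstrap `E ≤ E_*` on `[0, v]`
  have traj : ∀ k, ∀ v ∈ Icc 0 T, (∀ s ∈ Icc 0 v, E s ≤ Estar) → ∀ σ : ℝ, (σ = 1 ∨ σ = -1) →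
      σ * (μ k * F k v) ≤ B := by
    intro k v hv hboot σ hσ
    have hσabs : |σ| = 1 := by rcases hσ with rfl | rfl <;> simp
    have hvT : ∀ s ∈ Icc 0 v, s ∈ Icc 0 T := fun s hs => ⟨hs.1, hs.2.trans hv.2⟩
    -- the function `f = σ μ_k F_k` and its right derivative
    have hfc : ContinuousOn (fun s => σ * (μ k * F k s)) (Icc 0 v) :=
      (continuousOn_const.mul (continuousOn_const.mul ((hFc k).mono fun s hs => hvT s hs)))
    have hfd : ∀ s ∈ Ico 0 v, HasDerivWithinAt (fun s => σ * (μ k * F k s))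
        (σ * (μ k * (-A k s * F k s + G k s))) (Ici s) s := fun s hs =>
      ((hF k s ⟨hs.1, hs.2.trans_le hv.2⟩).const_mul (μ k)).const_mul σ
    refine image_le_of_deriv_right_lt_deriv_boundary' (f := fun s => σ * (μ k * F k s))
      (B := fun _ => B) (B' := fun _ => 0) hfc hfd ?_ continuousOn_const
      (fun s _ => hasDerivWithinAt_const s (Ici s) B) ?_ (right_mem_Icc.mpr hv.1)
    · -- at time 0: `σ μ F(0) ≤ μ|F(0)| ≤ E 0 ≤ B`
      have h1 : σ * (μ k * F k 0) ≤ μ k * |F k 0| := by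
        calc σ * (μ k * F k 0) ≤ |σ * (μ k * F k 0)| := le_abs_self _
          _ = μ k * |F k 0| := by rw [abs_mul, hσabs, one_mul, abs_mul, abs_of_pos (hμ k)]
      have h2 : μ k * |F k 0| ≤ E 0 := (hE 0 ⟨le_rfl, hv.1.trans hv.2⟩).1 ⟨k, rfl⟩
      exact h1.trans (h2.trans (le_max_left _ _))
    · -- touching points: the derivative is negative
      intro s hs hfs
      have hsT : s ∈ Icc 0 T := ⟨hs.1, hs.2.le.trans hv.2⟩
      obtain ⟨hApos, hkey⟩ := key k s hsT (hboot s ⟨hs.1, hs.2.le⟩)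
      have hGle : σ * (μ k * G k s) ≤ Φ k s (E s) := by
        calc σ * (μ k * G k s) ≤ |σ * (μ k * G k s)| := le_abs_self _
          _ = μ k * |G k s| := by rw [abs_mul, hσabs, one_mul, abs_mul, abs_of_pos (hμ k)]
          _ ≤ Φ k s (E s) := hG k s hsT
      have hexp : σ * (μ k * (-A k s * F k s + G k s)) =
          -A k s * (σ * (μ k * F k s)) + σ * (μ k * G k s) := by ring
      rw [hexp, hfs]
      nlinarith
  -- from the two signs: `μ_k |F_k(v)| ≤ B`
  have trajabs : ∀ k, ∀ v ∈ Icc 0 T, (∀ s ∈ Icc 0 v, E s ≤ Estar) → μ k * |F k v| ≤ B := by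
    intro k v hv hboot
    rw [← abs_of_pos (hμ k), ← abs_mul]
    refine abs_le.mpr ⟨?_, ?_⟩
    · have := traj k v hv hboot (-1) (Or.inr rfl); linarith
    · have := traj k v hv hboot 1 (Or.inl rfl); linarith
  -- bootstrap closure with `W = E`, barrier `B` (constant), slack `E_* − B`
  have hT : ∀ t ∈ Icc 0 T, E t ≤ B := by
    refine bootstrap_closure (W := E) (b := fun _ => B) hρ hEc continuousOn_const
      (fun _ _ _ _ _ => le_rfl) (le_max_left _ _) ?_
    intro v hv hslack
    exact isLUB_range_le (hE v hv) fun k =>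
      trajabs k v hv fun s hs => by linarith [hslack s hs]
  intro t ht
  exact (hT t ht).trans_lt hBlt

/-- **The printed quadratic form of the nonlinear stability lemma** (Part II Lemma 2.1 verbatim
along characteristics): forcing bounded by `a_k(t) E + a₂,k(t) E² + a₃,k(t)` with nonnegative
coefficient functions (`a = Σ_{j≠i}|a_ij|`, `a₂ = Σ|a_ij,2|`, `a₃ = Σ|a_ij,3|`), conditions
`A_k E_* − (a_k E_* + a₂,k E_*² + a₃,k) > ε₀` and `a_k E_* + a₂,k E_*² + a₃,k < M`;
then `E(0) < E_* ⟹ E(t) < E_*` on `[0,T]`. [cite: ChenHou2023RigorousNumerics, Lemma 2.1 (= arXiv:2210.07191 Appendix A.1, nonlinear stability lemma)] -/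
theorem chenHou_nonlinear_stability_quadratic {a a₂ a₃ : ι → ℝ → ℝ}
    (hEstar : 0 < Estar) (hε₀ : 0 < ε₀) (hM : 0 < M) (hμ : ∀ k, 0 < μ k)
    (hFc : ∀ k, ContinuousOn (F k) (Icc 0 T))
    (hF : ∀ k, ∀ t ∈ Ico 0 T, HasDerivWithinAt (F k) (-A k t * F k t + G k t) (Ici t) t)
    (ha : ∀ k, ∀ t ∈ Icc 0 T, 0 ≤ a k t ∧ 0 ≤ a₂ k t ∧ 0 ≤ a₃ k t)
    (hG : ∀ k, ∀ t ∈ Icc 0 T, μ k * |G k t| ≤ a k t * E t + a₂ k t * E t ^ 2 + a₃ k t)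
    (hgap : ∀ k, ∀ t ∈ Icc 0 T, ε₀ < A k t * Estar - (a k t * Estar + a₂ k t * Estar ^ 2 + a₃ k t))
    (hbd : ∀ k, ∀ t ∈ Icc 0 T, a k t * Estar + a₂ k t * Estar ^ 2 + a₃ k t < M)
    (hEc : ContinuousOn E (Icc 0 T))
    (hE : ∀ t ∈ Icc 0 T, IsLUB (Set.range fun k => μ k * |F k t|) (E t))
    (h0 : E 0 < Estar) :
    ∀ t ∈ Icc 0 T, E t < Estar := by
  refine chenHou_nonlinear_stability (Φ := fun k t e => a k t * e + a₂ k t * e ^ 2 + a₃ k t)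
    hEstar hε₀ hM hμ hFc hF hG ?_ hgap hbd hEc hE h0
  intro k t ht x hx y hy hxy
  obtain ⟨h1, h2, -⟩ := ha k t ht
  have : x ^ 2 ≤ y ^ 2 := by nlinarith [hx.1, hy.1]
  nlinarith [mul_le_mul_of_nonneg_left hxy h1, mul_le_mul_of_nonneg_left this h2]

end Nonlinear

/-! ### Lemma A.1: linear stability (exponential decay) -/

section Linear

variable {ι : Type*} {t₀ T lam M : ℝ} {μ : ι → ℝ} {F A G C : ι → ℝ → ℝ} {E : ℝ → ℝ}

/-- **Chen–Hou's linear stability lemma** (Part I, Appendix A.1, first lemma), trajectory form.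
Trajectories `F k` with right derivative `F_k' = −A_k F_k + G_k` on `[t₀,T)`, continuous on
`[t₀,T]`; weights `μ_k > 0`; energy `E(t) = sup_k μ_k|F_k(t)|` (`IsLUB`), continuous on
`[t₀,T]`; forcing `μ_k|G_k(t)| ≤ C_k(t) E(t)` with `0 ≤ C_k(t) ≤ M` (printed:
`C_i = Σ_{j≠i} μ_iμ_j⁻¹|a_ij|`); damping condition `A_k(t) − C_k(t) ≥ λ` (printed (eq:PDE_diag)).
Conclusion: `E(t) ≤ e^{−λ(t−t₀)} E(t₀)` for `t ∈ [t₀, T]`. (`λ` may be any real here.) [cite: arXiv221007191, Appendix A.1 (linear stability lemma; Lemma 8.1 of the arXiv text)] -/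
theorem chenHou_linear_stability (hM : 0 < M) (hμ : ∀ k, 0 < μ k)
    (hFc : ∀ k, ContinuousOn (F k) (Icc t₀ T))
    (hF : ∀ k, ∀ t ∈ Ico t₀ T, HasDerivWithinAt (F k) (-A k t * F k t + G k t) (Ici t) t)
    (hG : ∀ k, ∀ t ∈ Icc t₀ T, μ k * |G k t| ≤ C k t * E t)
    (hC : ∀ k, ∀ t ∈ Icc t₀ T, 0 ≤ C k t ∧ C k t ≤ M)
    (hgap : ∀ k, ∀ t ∈ Icc t₀ T, lam ≤ A k t - C k t)
    (hEc : ContinuousOn E (Icc t₀ T))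
    (hE : ∀ t ∈ Icc t₀ T, IsLUB (Set.range fun k => μ k * |F k t|) (E t)) :
    ∀ t ∈ Icc t₀ T, E t ≤ Real.exp (-lam * (t - t₀)) * E t₀ := by
  -- nonnegativity of the energy
  have hE0 : ∀ t ∈ Icc t₀ T, 0 ≤ E t := fun t ht =>
    isLUB_range_nonneg (hE t ht) fun k => mul_nonneg (hμ k).le (abs_nonneg _)
  -- the conjugated energy `W(t) = e^{λ(t−t₀)} E(t)`; it suffices to show `W ≤ E₀ + η(1 + (t−t₀))`
  -- for every `η > 0`
  set W : ℝ → ℝ := fun t => Real.exp (lam * (t - t₀)) * E t with hW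
  have hWc : ContinuousOn W (Icc t₀ T) := by
    refine ContinuousOn.mul ?_ hEc
    exact (Real.continuous_exp.comp (continuous_const.mul (continuous_id.sub continuous_const))).continuousOn
  suffices hmain : ∀ η > 0, ∀ t ∈ Icc t₀ T, W t ≤ (E t₀ + η) + η * (t - t₀) by
    intro t ht
    have hexp : 0 < Real.exp (lam * (t - t₀)) := Real.exp_pos _
    have hWle : W t ≤ E t₀ := by
      refine le_of_forall_pos_le_add fun ε hε => ?_
      have hc : 0 < 1 + (t - t₀) := by linarith [ht.1]
      have h := hmain (ε / (1 + (t - t₀))) (div_pos hε hc) t ht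
      have : (E t₀ + ε / (1 + (t - t₀))) + ε / (1 + (t - t₀)) * (t - t₀) = E t₀ + ε := by
        field_simp; ring
      linarith
    calc E t = Real.exp (-lam * (t - t₀)) * W t := by
          rw [hW]; dsimp only
          rw [← mul_assoc, ← Real.exp_add, show -lam * (t - t₀) + lam * (t - t₀) = 0 by ring,
            Real.exp_zero, one_mul]
      _ ≤ Real.exp (-lam * (t - t₀)) * E t₀ :=
          mul_le_mul_of_nonneg_left hWle (Real.exp_pos _).le
  intro η hη
  -- barrier `bη(t) = (E₀ + η) + η (t − t₀)`, slope `η`, slack `ρ = η/(2M)`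
  set bη : ℝ → ℝ := fun t => (E t₀ + η) + η * (t - t₀) with hbη
  have hbc : ContinuousOn bη (Icc t₀ T) :=
    (continuous_const.add (continuous_const.mul (continuous_id.sub continuous_const))).continuousOn
  have hbm : MonotoneOn bη (Icc t₀ T) := fun x _ y _ hxy => by
    simp only [hbη]; nlinarith
  have hbpos : ∀ t ∈ Icc t₀ T, 0 < bη t := fun t ht => by
    simp only [hbη]; nlinarith [hE0 t₀ ⟨le_rfl, ht.1.trans ht.2⟩, ht.1]
  have hW0 : W t₀ ≤ bη t₀ := by
    simp only [hW, hbη, sub_self, mul_zero, Real.exp_zero, one_mul, add_zero]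
    linarith
  have hρ : 0 < η / (2 * M) := by positivity
  refine bootstrap_closure (W := W) (b := bη) hρ hWc hbc hbm hW0 ?_
  intro v hv hslack
  -- one trajectory, one sign: `σ μ_k e^{λ(s−t₀)} F_k(s) ≤ bη(s)` on `[t₀, v]`
  have hvT : ∀ s ∈ Icc t₀ v, s ∈ Icc t₀ T := fun s hs => ⟨hs.1, hs.2.trans hv.2⟩
  have traj : ∀ k, ∀ σ : ℝ, (σ = 1 ∨ σ = -1) →
      σ * (μ k * (Real.exp (lam * (v - t₀)) * F k v)) ≤ bη v := by
    intro k σ hσ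
    have hσabs : |σ| = 1 := by rcases hσ with rfl | rfl <;> simp
    -- the function and its right derivative
    have hec : Continuous fun s : ℝ => Real.exp (lam * (s - t₀)) :=
      Real.continuous_exp.comp (continuous_const.mul (continuous_id.sub continuous_const))
    have hed : ∀ s, HasDerivAt (fun s : ℝ => Real.exp (lam * (s - t₀)))
        (Real.exp (lam * (s - t₀)) * (lam * 1)) s := fun s =>
      (((hasDerivAt_id s).sub_const t₀).const_mul lam).exp
    have hfc : ContinuousOn (fun s => σ * (μ k * (Real.exp (lam * (s - t₀)) * F k s))) (Icc t₀ v) :=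
      continuousOn_const.mul (continuousOn_const.mul
        (hec.continuousOn.mul ((hFc k).mono fun s hs => hvT s hs)))
    have hfd : ∀ s ∈ Ico t₀ v, HasDerivWithinAt
        (fun s => σ * (μ k * (Real.exp (lam * (s - t₀)) * F k s)))
        (σ * (μ k * (Real.exp (lam * (s - t₀)) * (lam * 1) * F k s +
          Real.exp (lam * (s - t₀)) * (-A k s * F k s + G k s)))) (Ici s) s := fun s hs =>
      (((hed s).hasDerivWithinAt.mul (hF k s ⟨hs.1, hs.2.trans_le hv.2⟩)).const_mul (μ k)).const_mul σ
    have hbd' : ∀ s ∈ Ico t₀ v, HasDerivWithinAt bη η (Ici s) s := fun s _ => by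
      have h : HasDerivAt bη (0 + η * (1 - 0)) s := by
        simp only [hbη]
        exact (hasDerivAt_const s _).add (((hasDerivAt_id s).sub (hasDerivAt_const s t₀)).const_mul η)
      simpa using h.hasDerivWithinAt
    refine image_le_of_deriv_right_lt_deriv_boundary'
      (f := fun s => σ * (μ k * (Real.exp (lam * (s - t₀)) * F k s))) (B := bη) (B' := fun _ => η)
      hfc hfd ?_ (hbc.mono (Icc_subset_Icc le_rfl hv.2)) hbd' ?_ (right_mem_Icc.mpr hv.1)
    · -- at time `t₀`
      have h1 : σ * (μ k * (Real.exp (lam * (t₀ - t₀)) * F k t₀)) ≤ μ k * |F k t₀| := by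
        rw [sub_self, mul_zero, Real.exp_zero, one_mul]
        calc σ * (μ k * F k t₀) ≤ |σ * (μ k * F k t₀)| := le_abs_self _
          _ = μ k * |F k t₀| := by rw [abs_mul, hσabs, one_mul, abs_mul, abs_of_pos (hμ k)]
      have h2 : μ k * |F k t₀| ≤ E t₀ := (hE t₀ ⟨le_rfl, hv.1.trans hv.2⟩).1 ⟨k, rfl⟩
      exact h1.trans (h2.trans (by linarith [hW0]))
    · -- touching points: derivative `≤ η/2 < η`
      intro s hs hfs
      have hsT : s ∈ Icc t₀ T := ⟨hs.1, hs.2.le.trans hv.2⟩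
      set e : ℝ := Real.exp (lam * (s - t₀)) with he
      have hepos : 0 < e := Real.exp_pos _
      obtain ⟨hC0, hCM⟩ := hC k s hsT
      have hg := hgap k s hsT
      -- forcing: `σ μ e G ≤ e C E = C W ≤ C (bη + ρ)`
      have hGle : σ * (μ k * (e * G k s)) ≤ C k s * W s := by
        calc σ * (μ k * (e * G k s)) ≤ |σ * (μ k * (e * G k s))| := le_abs_self _
          _ = e * (μ k * |G k s|) := by
              rw [abs_mul, hσabs, one_mul, abs_mul, abs_of_pos (hμ k), abs_mul, abs_of_pos hepos]
              ring
          _ ≤ e * (C k s * E s) := mul_le_mul_of_nonneg_left (hG k s hsT) hepos.le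
          _ = C k s * W s := by simp only [hW]; ring
      have hWs : W s ≤ bη s + η / (2 * M) := hslack s ⟨hs.1, hs.2.le⟩
      have hbs : 0 < bη s := hbpos s hsT
      have hexp' : σ * (μ k * (e * (lam * 1) * F k s + e * (-A k s * F k s + G k s))) =
          (lam - A k s) * (σ * (μ k * (e * F k s))) + σ * (μ k * (e * G k s)) := by ring
      rw [hexp', hfs]
      -- `(λ − A) bη + C W ≤ (λ − A + C) bη + C ρ ≤ M ρ = η/2 < η`
      have h3 : C k s * W s ≤ C k s * bη s + C k s * (η / (2 * M)) := by nlinarith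
      have h4 : C k s * (η / (2 * M)) ≤ M * (η / (2 * M)) := mul_le_mul_of_nonneg_right hCM hρ.le
      have h5 : M * (η / (2 * M)) = η / 2 := by field_simp
      nlinarith
  -- from the two signs, `μ_k e^{λ(v−t₀)} |F_k v| ≤ bη v`, hence `W v ≤ bη v`
  have hev : 0 < Real.exp (lam * (v - t₀)) := Real.exp_pos _
  have habs : ∀ k, μ k * |F k v| ≤ Real.exp (-lam * (v - t₀)) * bη v := by
    intro k
    have h1 := traj k 1 (Or.inl rfl)
    have h2 := traj k (-1) (Or.inr rfl)
    have h3 : |μ k * (Real.exp (lam * (v - t₀)) * F k v)| ≤ bη v := abs_le.mpr ⟨by linarith, by linarith⟩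
    rw [abs_mul, abs_of_pos (hμ k), abs_mul, abs_of_pos hev] at h3
    rw [show Real.exp (-lam * (v - t₀)) = (Real.exp (lam * (v - t₀)))⁻¹ by
      rw [← Real.exp_neg]; ring_nf]
    rw [le_inv_mul_iff₀ hev]
    calc Real.exp (lam * (v - t₀)) * (μ k * |F k v|) = μ k * (Real.exp (lam * (v - t₀)) * |F k v|) := by
          ring
      _ ≤ bη v := h3
  have hEv : E v ≤ Real.exp (-lam * (v - t₀)) * bη v := isLUB_range_le (hE v hv) habs
  calc W v = Real.exp (lam * (v - t₀)) * E v := rfl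
    _ ≤ Real.exp (lam * (v - t₀)) * (Real.exp (-lam * (v - t₀)) * bη v) :=
        mul_le_mul_of_nonneg_left hEv hev.le
    _ = bη v := by
        rw [← mul_assoc, ← Real.exp_add, show lam * (v - t₀) + -lam * (v - t₀) = 0 by ring,
          Real.exp_zero, one_mul]

end Linear


end Literature.Analysis.FluidPDE
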